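import Mathlib
import HarnessLib
import Summits.NavierStokesRegularity.NavierStokesRegularity.Theorems.PoloidalWindowDoorLrcModEntireJetCertPsatzElimG

/-!
# Jet-certificate checker — content removal, ECONOMICAL variant (strip only the laws the pivot touched)

Cell pub-ns-dss, seat ns-crc-p1 gen 5 (Lean-certificate hand of `ns-wall-extremal`, arm C; PREREG-WALL-1 §C, C1a/C1b/C2 all-tilt cells), 2026-08-28.
`--supports stmt-NavierStokesRegularity-19708` (instrument).  Generic; no Navier–Stokes content.  `…JetCertPsatzElimG` strips the content of EVERY law after
every pivot; on the all-tilt cell T1′(5,2) (118 laws, 27 k terms, 171 steps) that costs 480 s on the farm and timed out at the gate (600 s), although only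
the handful of laws containing the pivot letter change in a step.  Here a law WITHOUT the pivot letter is left untouched (`substStrip`); everything
else — nodes, semantics, soundness statement (`Kills`) — is identical.

* `substStrip`, `ev_substStrip_eq_zero`; `etreeCheckH` + `not_pointDatum_of_etreeCheckH`; `killCheckH` + **`kills_of_killCheckH`**; self-test.

WHAT THIS IS NOT: not a claim about Navier–Stokes, not a certificate. [folklore]
-/

noncomputable section

-- the summit and its single sub-problem share the name (CONVENTIONS §1), as in every Theorems file
set_option linter.dupNamespace false

namespace Summit.NavierStokesRegularity.NavierStokesRegularity.Theorems.PoloidalWindowDoorLrcModEntireJetCertPsatzElimH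

open _root_.Topology _root_.Filter Set
open Literature.Analysis.ValidatedNumerics Literature.Analysis.ValidatedNumerics.QMvPoly
open Literature.Analysis.Calculus.MvPoly
open Summit.NavierStokesRegularity.NavierStokesRegularity.Theorems.PoloidalWindowDoorLrcModEntireJetCertDefs
open Summit.NavierStokesRegularity.NavierStokesRegularity.Theorems.PoloidalWindowDoorLrcModEntireJetCertTree
open Summit.NavierStokesRegularity.NavierStokesRegularity.Theorems.PoloidalWindowDoorLrcModEntireJetCertFast2
open Summit.NavierStokesRegularity.NavierStokesRegularity.Theorems.PoloidalWindowDoorLrcModEntireJetCertGauge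
open Summit.NavierStokesRegularity.NavierStokesRegularity.Theorems.PoloidalWindowDoorLrcModEntireJetCertPsatz
open Summit.NavierStokesRegularity.NavierStokesRegularity.Theorems.PoloidalWindowDoorLrcModEntireJetCertPsatzSubst
open Summit.NavierStokesRegularity.NavierStokesRegularity.Theorems.PoloidalWindowDoorLrcModEntireJetCertPsatzElim
open Summit.NavierStokesRegularity.NavierStokesRegularity.Theorems.PoloidalWindowDoorLrcModEntireJetCertPsatzElimN
open Summit.NavierStokesRegularity.NavierStokesRegularity.Theorems.PoloidalWindowDoorLrcModEntireJetCertPsatzElimG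

variable {n : ℕ}

/-- Substitute-and-strip for ONE law: untouched if the pivot letter `X_i` does not occur, else substituted (`substLawN`) and content-stripped (`stripC`). [folklore] -/
def substStrip (n g i : ℕ) (num c : QMvPoly) (P : QMvPoly) : QMvPoly :=
  if degIn i P = 0 then P else stripC n g (substLawN i num c P)

/-- Laws stay laws under substitute-and-strip (at a point with `z_g ≠ 0` and `c(z)·z_i = num(z)`). [folklore] -/
theorem ev_substStrip_eq_zero (z : EuclideanSpace ℝ (Fin n)) (g i : Fin n) (num c : QMvPoly) (hg : z g ≠ 0)
    (hz : ev n c z * z i = ev n num z) {p : QMvPoly} (hp : ev n p z = 0) : ev n (substStrip n g i num c p) z = 0 := by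
  unfold substStrip
  split_ifs with hd
  · exact hp
  · exact ev_stripC_eq_zero z g hg (ev_substLawN_eq_zero z i num c hz hp)

/-- **THE TRANSCRIPT CHECK with content removal, economical variant**: as `etreeCheckG`, but a law untouched by the pivot (no `X_i`) is left as it is (it was stripped when it last changed). [folklore] -/
def etreeCheckH (n g : ℕ) : List QMvPoly → List QMvPoly → List ℕ → List QMvPoly → ETree → Bool
  | hyps, pins, zs, nonneg, .leaf c => pointCheckP n hyps pins zs nonneg c
  | hyps, pins, zs, nonneg, .chunk comb T t =>
      polyEq T (idealComb hyps comb) && etreeCheckH n g (hyps ++ [T]) pins zs nonneg t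
  | hyps, pins, zs, nonneg, .split π nz z => etreeCheckH n g hyps (pins ++ [π]) zs nonneg nz && etreeCheckH n g (hyps ++ [π]) pins zs nonneg z
  | hyps, pins, zs, nonneg, .elim k i κ pe t =>
      let L := hyps.getD k []
      let c := coeffIn i L
      let num := QMvPoly.smul (-1) (restIn i L)
      decide (i < n) && decide (g < n) && hasVarPin n g pins && decide (κ ≠ 0) && decide (degIn i L ≤ 1) &&
        polyEq c (QMvPoly.smul κ (pinProductN pins pe)) &&
        etreeCheckH n g (hyps.map (substStrip n g i num c)) (pins.map (substLawN i num c)) zs (nonneg.map (substSignN i num c)) t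
  | hyps, pins, zs, nonneg, .force k j κ pe e t =>
      decide (j < n) && decide (κ ≠ 0) && decide (1 ≤ e) &&
        polyEq (hyps.getD k []) (QMvPoly.smul κ (mulN (pinProductN pins pe) (powQN (QMvPoly.var n j) e))) &&
        etreeCheckH n g (hyps ++ [QMvPoly.var n j]) pins zs nonneg t

/-- **SOUNDNESS (economical variant).** [folklore] -/
theorem not_pointDatum_of_etreeCheckH (g : ℕ) : ∀ (t : ETree) {hyps pins : List QMvPoly} {zs : List ℕ} {nonneg : List QMvPoly},
    etreeCheckH n g hyps pins zs nonneg t = true → ¬ PointDatum n hyps pins zs nonneg := by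
  intro t
  induction t with
  | leaf c => intro hyps pins zs nonneg h; exact not_pointDatum_of_pointCheckP h
  | chunk comb T t ih =>
    intro hyps pins zs nonneg h hd
    simp only [etreeCheckH, Bool.and_eq_true] at h
    obtain ⟨z, hh, hp, hz, hq⟩ := hd
    refine ih h.2 ⟨z, ?_, hp, hz, hq⟩
    intro L hL
    rcases List.mem_append.1 hL with hL' | hL'
    · exact hh L hL'
    · rw [List.mem_singleton.1 hL', ev_eq_of_polyEq h.1 z, ev_idealComb_eq_zero z hyps hh]
  | split π nz zt ihnz ihz =>
    intro hyps pins zs nonneg h hd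
    simp only [etreeCheckH, Bool.and_eq_true] at h
    obtain ⟨z, hh, hp, hz, hq⟩ := hd
    by_cases hπ : ev n π z = 0
    · refine ihz h.2 ⟨z, ?_, hp, hz, hq⟩
      intro L hL
      rcases List.mem_append.1 hL with hL' | hL'
      · exact hh L hL'
      · rw [List.mem_singleton.1 hL']; exact hπ
    · refine ihnz h.1 ⟨z, hh, ?_, hz, hq⟩
      intro π' hπ'
      rcases List.mem_append.1 hπ' with h' | h'
      · exact hp π' h'
      · rw [List.mem_singleton.1 h']; exact hπ
  | elim k i κ pe t ih =>
    intro hyps pins zs nonneg h hd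
    simp only [etreeCheckH, Bool.and_eq_true, decide_eq_true_eq] at h
    obtain ⟨⟨⟨⟨⟨⟨hi, hgn⟩, hvp⟩, hκ⟩, hdeg⟩, hc⟩, ht⟩ := h
    obtain ⟨z, hh, hp, hz, hq⟩ := hd
    set L := hyps.getD k [] with hL
    set c := coeffIn i L with hc_def
    set num := QMvPoly.smul (-1) (restIn i L) with hnum
    have hcz : ev n c z ≠ 0 := by
      rw [ev_eq_of_polyEq hc z, ev_smul, ev_pinProductN]
      exact mul_ne_zero (by exact_mod_cast hκ) (ev_pinProduct_ne_zero z pins pe hp)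
    have hLz : ev n L z = 0 := ev_getD_eq_zero hh k
    have hlin := ev_linear_split z ⟨i, hi⟩ L hdeg
    have hzi : ev n c z * z ⟨i, hi⟩ = ev n num z := by
      rw [hnum, ev_smul]; push_cast
      have : z ⟨i, hi⟩ * ev n c z + ev n (restIn i L) z = 0 := by rw [← hLz, hlin]
      linarith
    have hzg : z ⟨g, hgn⟩ ≠ 0 := zg_ne_zero_of_hasVarPin (g := ⟨g, hgn⟩) hvp hp
    refine ih ht ⟨z, ?_, ?_, hz, ?_⟩
    · intro L' hL'
      obtain ⟨P, hP, rfl⟩ := List.mem_map.1 hL'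
      exact ev_substStrip_eq_zero z ⟨g, hgn⟩ ⟨i, hi⟩ num c hzg hzi (hh P hP)
    · intro π' hπ'
      obtain ⟨P, hP, rfl⟩ := List.mem_map.1 hπ'
      exact ev_substLawN_ne_zero z ⟨i, hi⟩ num c hzi hcz (hp P hP)
    · intro q' hq'
      obtain ⟨P, hP, rfl⟩ := List.mem_map.1 hq'
      exact ev_substSignN_nonneg z ⟨i, hi⟩ num c hzi (hq P hP)
  | force k j κ pe e t ih =>
    intro hyps pins zs nonneg h hd
    simp only [etreeCheckH, Bool.and_eq_true, decide_eq_true_eq] at h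
    obtain ⟨⟨⟨⟨hj, hκ⟩, he⟩, hform⟩, ht⟩ := h
    obtain ⟨z, hh, hp, hz, hq⟩ := hd
    have hLz : ev n (hyps.getD k []) z = 0 := ev_getD_eq_zero hh k
    rw [ev_eq_of_polyEq hform z, ev_smul, ev_mulN, ev_pinProductN, ev_powQN, ev_var z ⟨j, hj⟩] at hLz
    have hzj : z ⟨j, hj⟩ = 0 := by
      have h1 : (κ : ℝ) ≠ 0 := by exact_mod_cast hκ
      have h2 := ev_pinProduct_ne_zero z pins pe hp
      have h3 : z ⟨j, hj⟩ ^ e = 0 := by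
        rcases mul_eq_zero.1 hLz with h | h
        · exact absurd h h1
        · rcases mul_eq_zero.1 h with h' | h'
          · exact absurd h' h2
          · exact h'
      exact pow_eq_zero_iff (by omega) |>.1 h3
    refine ih ht ⟨z, ?_, hp, hz, hq⟩
    intro L hL
    rcases List.mem_append.1 hL with hL' | hL'
    · exact hh L hL'
    · rw [List.mem_singleton.1 hL', ev_var z ⟨j, hj⟩]; exact hzj

/-- **THE KILL CHECK, economical content removal** (`g` = the pinned tilt letter). [folklore] -/
def killCheckH (n g : ℕ) (hyps pins : List QMvPoly) (zs : List ℕ) (nonneg : List QMvPoly) (J : List ℕ) (t : ETree) : Bool :=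
  (J.all fun j => decide (j < n)) && etreeCheckH n g hyps (pins ++ [sumSq n J]) zs nonneg t

/-- **SOUNDNESS OF THE KILL CHECK (economical variant).** [folklore] -/
theorem kills_of_killCheckH {g : ℕ} {hyps pins : List QMvPoly} {zs : List ℕ} {nonneg : List QMvPoly} {J : List ℕ} {t : ETree}
    (h : killCheckH n g hyps pins zs nonneg J t = true) : Kills n hyps pins zs nonneg J := by
  simp only [killCheckH, Bool.and_eq_true, List.all_eq_true, decide_eq_true_eq] at h
  obtain ⟨-, ht⟩ := h
  intro z hh hp hz hq j hjJ hj
  by_contra hne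
  refine not_pointDatum_of_etreeCheckH g t ht ⟨z, hh, ?_, hz, hq⟩
  intro π hπ
  rcases List.mem_append.1 hπ with h' | h'
  · exact hp π h'
  · rw [List.mem_singleton.1 h', ev_sumSq]
    have hnn : ∀ x ∈ J.map (fun j => ev n (QMvPoly.var n j) z * ev n (QMvPoly.var n j) z), (0 : ℝ) ≤ x := by
      intro x hx
      obtain ⟨j', -, rfl⟩ := List.mem_map.1 hx
      exact mul_self_nonneg _
    have hmem : ev n (QMvPoly.var n j) z * ev n (QMvPoly.var n j) z ∈
        J.map (fun j => ev n (QMvPoly.var n j) z * ev n (QMvPoly.var n j) z) := List.mem_map.2 ⟨j, hjJ, rfl⟩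
    have hle := List.single_le_sum hnn _ hmem
    have hpos : 0 < ev n (QMvPoly.var n j) z * ev n (QMvPoly.var n j) z := by
      rw [ev_var z ⟨j, hj⟩]; exact mul_self_pos.2 hne
    exact ne_of_gt (lt_of_lt_of_le hpos hle)

/-! ### Self-test (`decide +kernel`) -/

/-- The toy transcript of `…JetCertPsatzElimG` replays identically in the economical variant. [folklore] -/
theorem example_killCheckH :
    killCheckH 3 0 [[([1, 1, 0], (1 : ℚ)), ([0, 0, 0], (-1 : ℚ)), ([2, 0, 0], (-1 : ℚ))], [([0, 1, 1], (1 : ℚ)), ([1, 0, 1], (-1 : ℚ))]]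
      [QMvPoly.var 3 0] [] [] [2]
      (.elim 0 1 1 [1] (.force 1 2 1 [] 1 (.elim 2 2 1 [] (.leaf { steps := [], comb := [], e := [0, 1], sos0 := [], sosG := [] })))) = true := by
  decide +kernel

end Summit.NavierStokesRegularity.NavierStokesRegularity.Theorems.PoloidalWindowDoorLrcModEntireJetCertPsatzElimH

end
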